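import Mathlib
import Summits.Ventures.PercRepro2.Defs
import Summits.Ventures.PercRepro2.Graph
import Summits.Ventures.PercRepro2.Induced
import Summits.Ventures.PercRepro2.VdBKahn
import Summits.Ventures.PercRepro2.ReimerVdBK
import Summits.Ventures.PercRepro2.ReimerVdBKRegions
import Summits.Ventures.PercRepro2.ReimerVdBKZClosed
import Summits.Ventures.PercRepro2.ReimerVdBKZReduction
import Summits.Ventures.PercRepro2.ReimerVdBKZSplit
import Summits.Ventures.PercRepro2.ReimerVdBKZRecursion
import Summits.Ventures.PercRepro2.ReimerVdBKTypeWeight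
import Summits.Ventures.PercRepro2.ReimerVdBKPairType

/-!
# (R-1.2) follows from the Harris-pair case of (CORE↓)
(blind cell PercRepro2, mine-c g46; `conjectures/MINE-C.md` §55.3)

The cell's (CORE↓) (`MINE-C.md` §53.4 (d)) is: for every instance and every set `S ∋ s`,
`#{ω ∈ L : K₁ ∩ K₂ ⊆ S} ≤ #{ω ∈ R : K₁ ∩ K₂ ⊆ S}`; with `N = V ∖ S` this is the two-world count restricted to
the colourings whose CORE `K₁ ∩ K₂` avoids `N` (`coreCount`), and (R-1.2) is its case `N = ∅`.  Its HARRIS-PAIR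
case (`X ∩ Y = ∅`, `N` unmarked) is `CoreDown`.  THEOREM `rvdBK_of_coreDown`: if `CoreDown` holds for every
Harris pair and every unmarked `N` on every graph (with the given vertex and edge types), then (R-1.2) holds
for every instance on every such graph — the reduction `pstmt_of_harris` of `ReimerVdBKPairType`, translated:
`reimerCount` is the product count of the mark weights (`reimerCount_eq_pcount`), the mark weights of an
instance are the left / right weights of its pair types (`lwMark_eq_lwt`, `lwMark_right_eq_rwt`), and a
Harris assignment is a Harris pair with a core-avoided set (`coreW_eq_lwt`, `coreW_right_eq_rwt`).
Census: (CORE↓) has 0 violations on every graph with ≤ 6 vertices and every 7-vertex graph with ≤ 13 edges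
(`MINE-C.md` §53.7, §53.10); its Harris-pair case with `|N| ≤ 6` on all 6-vertex graphs and random 7-vertex
graphs: kit j330085 (§55.3).
-/

namespace Summit.Ventures.PercRepro2
namespace ReimerVdBK
open Classical PairType

variable {V : Type*} {E : Type*} [Fintype E] [DecidableEq E] [Fintype V] [DecidableEq V]

/-! ## Mark weights -/

/-- The unit type weight. -/
def tOne : TW := (1, 1, 1, 1)

/-- The left mark weight of the instance `(A, X; B, Y)` at `v`: the product of the weights of its marks. -/
def lwMark (A X B Y : Finset V) (v : V) : TW :=
  tmul (tmul (if v ∈ A then (1, 1, 0, 0) else tOne) (if v ∈ X then (0, 0, 1, 1) else tOne))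
    (tmul (if v ∈ B then (1, 0, 1, 0) else tOne) (if v ∈ Y then (0, 1, 0, 1) else tOne))

/-- The mark weight with the core-avoidance weight `(0, 1, 1, 1)` on the vertices of `N`. -/
def coreW (A X B Y N : Finset V) (v : V) : TW :=
  tmul (lwMark A X B Y v) (if v ∈ N then (0, 1, 1, 1) else tOne)

/-- The unit weight is neutral. -/
lemma tmul_tOne (w : TW) : tmul w tOne = w := by
  obtain ⟨a, b, c, d⟩ := w
  simp [tmul, tOne]

/-- The unit weight weighs `1`. -/
lemma tw_tOne (b₁ b₂ : Bool) : tw tOne b₁ b₂ = 1 := by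
  cases b₁ <;> cases b₂ <;> rfl

/-- A conditional mark weight. -/
lemma tw_ite (c : Prop) [Decidable c] (w : TW) (b₁ b₂ : Bool) :
    tw (if c then w else tOne) b₁ b₂ = if c then tw w b₁ b₂ else 1 := by
  split_ifs
  · rfl
  · exact tw_tOne b₁ b₂

/-- The weight of an `A`-mark: `[in world 1]`. -/
lemma tw_A (b₁ b₂ : Bool) : tw (1, 1, 0, 0) b₁ b₂ = if b₁ then 1 else 0 := by
  cases b₁ <;> cases b₂ <;> rfl

/-- The weight of an `X`-mark: `[not in world 1]`. -/
lemma tw_X (b₁ b₂ : Bool) : tw (0, 0, 1, 1) b₁ b₂ = if b₁ then 0 else 1 := by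
  cases b₁ <;> cases b₂ <;> rfl

/-- The weight of a `B`-mark: `[in world 2]`. -/
lemma tw_B (b₁ b₂ : Bool) : tw (1, 0, 1, 0) b₁ b₂ = if b₂ then 1 else 0 := by
  cases b₁ <;> cases b₂ <;> rfl

/-- The weight of a `Y`-mark: `[not in world 2]`. -/
lemma tw_Y (b₁ b₂ : Bool) : tw (0, 1, 0, 1) b₁ b₂ = if b₂ then 0 else 1 := by
  cases b₁ <;> cases b₂ <;> rfl

/-- The core-avoidance weight: `[not in both worlds]`. -/
lemma tw_N (b₁ b₂ : Bool) : tw (0, 1, 1, 1) b₁ b₂ = if b₁ ∧ b₂ then 0 else 1 := by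
  cases b₁ <;> cases b₂ <;> rfl

variable (ends : E → Sym2 V) (s : V)

/-- The core-avoidance condition of the vertex `v`. -/
def CoreCond (A X B Y N : Finset V) (ω : Config E) (v : V) : Prop :=
  (v ∈ A → Conn ends ω s v) ∧ (v ∈ X → ¬ Conn ends ω s v) ∧ (v ∈ B → Conn ends (compl ω) s v) ∧
    (v ∈ Y → ¬ Conn ends (compl ω) s v) ∧ (v ∈ N → ¬ (Conn ends ω s v ∧ Conn ends (compl ω) s v))

/-- A product of two `0 / 1` indicators is the indicator of the conjunction. -/
lemma ite_one_zero_mul (a b : Prop) [Decidable a] [Decidable b] :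
    (if a then (1 : ℕ) else 0) * (if b then 1 else 0) = if a ∧ b then 1 else 0 := by
  by_cases ha : a <;> by_cases hb : b <;> simp [ha, hb]

/-- The factor of a world-1 connection mark. -/
lemma factor_conn (c p : Prop) [Decidable c] :
    (if c then (if cdec p then (1 : ℕ) else 0) else 1) = if (c → p) then 1 else 0 := by
  by_cases hc : c <;> by_cases hp : p <;> simp [hc, hp, cdec_eq_true, cdec_eq_false]

/-- The factor of an avoidance mark. -/
lemma factor_avoid (c p : Prop) [Decidable c] :
    (if c then (if cdec p then (0 : ℕ) else 1) else 1) = if (c → ¬ p) then 1 else 0 := by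
  by_cases hc : c <;> by_cases hp : p <;> simp [hc, hp, cdec_eq_true, cdec_eq_false]

/-- The factor of a core-avoidance mark. -/
lemma factor_core (c p q : Prop) [Decidable c] :
    (if c then (if cdec p ∧ cdec q then (0 : ℕ) else 1) else 1) = if (c → ¬ (p ∧ q)) then 1 else 0 := by
  by_cases hc : c <;> by_cases hp : p <;> by_cases hq : q <;>
    simp [hc, hp, hq, cdec_eq_true, cdec_eq_false]

omit [Fintype E] [DecidableEq E] [Fintype V] in
/-- The weight of `v` under `coreW` is the indicator of its core-avoidance condition. -/
lemma vw_coreW (A X B Y N : Finset V) (ω : Config E) (v : V) :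
    vw ends s (coreW A X B Y N) ω v = if CoreCond ends s A X B Y N ω v then 1 else 0 := by
  unfold vw coreW lwMark CoreCond
  rw [tw_tmul, tw_tmul, tw_tmul, tw_tmul, tw_ite, tw_ite, tw_ite, tw_ite, tw_ite, tw_A, tw_X, tw_B,
    tw_Y, tw_N, factor_conn, factor_avoid, factor_conn, factor_avoid, factor_core, ite_one_zero_mul,
    ite_one_zero_mul, ite_one_zero_mul, ite_one_zero_mul]
  congr 1
  apply propext
  tauto

/-- **The weighted count is a count**: `pcount (coreW A X B Y N)` is the number of colourings of the two-world
event of `(A, X; B, Y)` whose core `K₁ ∩ K₂` avoids `N`. -/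
theorem pcount_coreW_eq_count (A X B Y N : Finset V) :
    pcount ends s (coreW A X B Y N) =
      count (twoWorld ends s A X B Y ∩
        {ω | ∀ v ∈ N, ¬ (Conn ends ω s v ∧ Conn ends (compl ω) s v)}) := by
  unfold pcount count
  refine Finset.sum_congr rfl fun ω _ => ?_
  simp only [vw_coreW]
  rw [Finset.prod_boole]
  congr 1
  apply propext
  simp only [Finset.mem_univ, true_imp_iff, twoWorld, connAll, avoidAll, Set.mem_inter_iff,
    Set.mem_setOf_eq, mem_bar, CoreCond]
  constructor
  · intro h
    exact ⟨⟨⟨fun a ha => (h a).1 ha, fun x hx => (h x).2.1 hx⟩,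
      fun b hb => (h b).2.2.1 hb, fun y hy => (h y).2.2.2.1 hy⟩, fun v hv => (h v).2.2.2.2 hv⟩
  · rintro ⟨⟨⟨hA, hX⟩, hB, hY⟩, hN⟩ v
    exact ⟨hA v, hX v, hB v, hY v, hN v⟩

/-- The Reimer count is the product count of the mark weights. -/
theorem reimerCount_eq_pcount (A X B Y : Finset V) :
    reimerCount ends s A X B Y = pcount ends s (lwMark A X B Y) := by
  have h : lwMark A X B Y = coreW A X B Y ∅ := by
    funext v; rw [coreW, if_neg (Finset.notMem_empty v), tmul_tOne]
  rw [h, pcount_coreW_eq_count]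
  unfold reimerCount
  congr 1
  ext ω
  simp

/-! ## (CORE↓) on Harris pairs -/

/-- The core-restricted two-world count: the colourings of the two-world event of `(A, X; B, Y)` whose
core avoids `N` (`pcount_coreW_eq_count`). -/
noncomputable def coreCount (A X B Y N : Finset V) : ℕ := pcount ends s (coreW A X B Y N)

/-- **(CORE↓) for the Harris pair `(A, X; B, Y)` and the set `N`**: the core-restricted left count is at most
the core-restricted right count.  (Meant for `X ∩ Y = ∅`, `A ∩ X = B ∩ Y = ∅`, `N` unmarked — then the
right instance is the right side of (R-1.2).) -/
def CoreDown (A X B Y N : Finset V) : Prop :=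
  coreCount ends s A X B Y N ≤ coreCount ends s (A ∪ B) ∅ ∅ (X ∪ Y) N

/-! ## Instances as pair-type assignments -/

omit [Fintype E] [DecidableEq E] [Fintype V] in
/-- The pair type of the vertex `v` in the instance `(A, X; B, Y)`. -/
def instType (A X B Y : Finset V) (v : V) : PairType :=
  if v ∈ A then (if v ∈ B then PairType.AB else if v ∈ Y then PairType.AY else PairType.A)
  else if v ∈ B then (if v ∈ X then PairType.BX else PairType.B)
  else if v ∈ X then (if v ∈ Y then PairType.Z else PairType.X)
  else if v ∈ Y then PairType.Y else PairType.U

omit [Fintype E] [DecidableEq E] [Fintype V] in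
/-- The left mark weight is the left weight of the pair type. -/
lemma lwMark_eq_lwt {A X B Y : Finset V} (hAX : Disjoint A X) (hBY : Disjoint B Y) (v : V) :
    lwMark A X B Y v = lwt (instType A X B Y v) := by
  have h1 : v ∈ A → v ∉ X := fun h => Finset.disjoint_left.1 hAX h
  have h2 : v ∈ B → v ∉ Y := fun h => Finset.disjoint_left.1 hBY h
  by_cases hA : v ∈ A <;> by_cases hB : v ∈ B <;> by_cases hX : v ∈ X <;> by_cases hY : v ∈ Y <;>
    simp_all [lwMark, instType, tmul, tOne, lwt]

omit [Fintype E] [DecidableEq E] [Fintype V] in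
/-- The left mark weight of the right-hand instance is the right weight of the pair type. -/
lemma lwMark_right_eq_rwt {A X B Y : Finset V} (hAX : Disjoint A X) (hBY : Disjoint B Y) (v : V) :
    lwMark (A ∪ B) (X ∩ Y) ∅ (X ∪ Y) v = rwt (instType A X B Y v) := by
  have h1 : v ∈ A → v ∉ X := fun h => Finset.disjoint_left.1 hAX h
  have h2 : v ∈ B → v ∉ Y := fun h => Finset.disjoint_left.1 hBY h
  by_cases hA : v ∈ A <;> by_cases hB : v ∈ B <;> by_cases hX : v ∈ X <;> by_cases hY : v ∈ Y <;>
    simp_all [lwMark, instType, tmul, tOne, rwt]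

/-- The marks of a Harris assignment: `A`-vertices. -/
def harA (P : V → PairType) : Finset V := Finset.univ.filter fun v => P v = A ∨ P v = AY ∨ P v = AB
/-- The marks of a Harris assignment: `X`-vertices. -/
def harX (P : V → PairType) : Finset V := Finset.univ.filter fun v => P v = X ∨ P v = BX
/-- The marks of a Harris assignment: `B`-vertices. -/
def harB (P : V → PairType) : Finset V := Finset.univ.filter fun v => P v = B ∨ P v = BX ∨ P v = AB
/-- The marks of a Harris assignment: `Y`-vertices. -/
def harY (P : V → PairType) : Finset V := Finset.univ.filter fun v => P v = Y ∨ P v = AY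
/-- The core-avoided vertices of a Harris assignment. -/
def harN (P : V → PairType) : Finset V := Finset.univ.filter fun v => P v = F 0

omit [Fintype E] [DecidableEq E] in
/-- The left weight of a Harris assignment is the core mark weight of its instance. -/
lemma coreW_eq_lwt (P : V → PairType) (hP : ∀ v, (P v).IsHarris) (v : V) :
    coreW (harA P) (harX P) (harB P) (harY P) (harN P) v = lwt (P v) := by
  have h := hP v
  simp only [coreW, lwMark, harA, harX, harB, harY, harN, Finset.mem_filter, Finset.mem_univ, true_and]
  cases hv : P v <;> simp_all [IsHarris, tmul, tOne, lwt]

omit [Fintype E] [DecidableEq E] in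
/-- The right weight of a Harris assignment is the core mark weight of the right-hand instance. -/
lemma coreW_right_eq_rwt (P : V → PairType) (hP : ∀ v, (P v).IsHarris) (v : V) :
    coreW (harA P ∪ harB P) ∅ ∅ (harX P ∪ harY P) (harN P) v = rwt (P v) := by
  have h := hP v
  simp only [coreW, lwMark, harA, harX, harB, harY, harN, Finset.mem_filter, Finset.mem_univ, true_and,
    Finset.mem_union, Finset.notMem_empty]
  cases hv : P v <;> simp_all [IsHarris, tmul, tOne, rwt]

omit [Fintype E] [DecidableEq E] in
/-- The instance of a Harris assignment is a Harris pair with an unmarked core-avoided set. -/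
lemma har_props (P : V → PairType) :
    harX P ∩ harY P = ∅ ∧ Disjoint (harA P) (harX P) ∧ Disjoint (harB P) (harY P) ∧
      ∀ v ∈ harN P, v ∉ harA P ∪ harB P ∪ harX P ∪ harY P := by
  refine ⟨?_, ?_, ?_, ?_⟩
  · apply Finset.eq_empty_iff_forall_notMem.2
    intro v hv
    rw [Finset.mem_inter, harX, harY, Finset.mem_filter, Finset.mem_filter] at hv
    obtain ⟨⟨-, h1⟩, -, h2⟩ := hv
    rcases h1 with h1 | h1 <;> rcases h2 with h2 | h2 <;> rw [h1] at h2 <;> cases h2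
  · rw [Finset.disjoint_left]
    intro v h1 h2
    rw [harA, Finset.mem_filter] at h1
    rw [harX, Finset.mem_filter] at h2
    obtain ⟨-, h1⟩ := h1
    obtain ⟨-, h2⟩ := h2
    rcases h1 with h1 | h1 | h1 <;> rcases h2 with h2 | h2 <;> rw [h1] at h2 <;> cases h2
  · rw [Finset.disjoint_left]
    intro v h1 h2
    rw [harB, Finset.mem_filter] at h1
    rw [harY, Finset.mem_filter] at h2
    obtain ⟨-, h1⟩ := h1
    obtain ⟨-, h2⟩ := h2
    rcases h1 with h1 | h1 | h1 <;> rcases h2 with h2 | h2 <;> rw [h1] at h2 <;> cases h2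
  · intro v hv h
    rw [harN, Finset.mem_filter] at hv
    obtain ⟨-, hv⟩ := hv
    rw [Finset.mem_union, Finset.mem_union, Finset.mem_union, harA, harB, harX, harY,
      Finset.mem_filter, Finset.mem_filter, Finset.mem_filter, Finset.mem_filter] at h
    rw [hv] at h
    simp at h

/-! ## The theorem -/

/-- **(R-1.2) follows from (CORE↓) on Harris pairs.**  If for every graph (on the given vertex and edge
types), every Harris pair `(A, X; B, Y)` (`X ∩ Y = ∅`, `A ∩ X = B ∩ Y = ∅`) and every unmarked set `N`
the core-restricted counts are ordered, `coreCount A X B Y N ≤ coreCount (A ∪ B) ∅ ∅ (X ∪ Y) N`, then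
`Φ(A, X; B, Y) ≤ Φ(A ∪ B, X ∩ Y; ∅, X ∪ Y)` for every instance on every such graph. -/
theorem rvdBK_of_coreDown
    (hCD : ∀ (ends : E → Sym2 V) (A X B Y N : Finset V), X ∩ Y = ∅ → Disjoint A X → Disjoint B Y →
      (∀ v ∈ N, v ∉ A ∪ B ∪ X ∪ Y) → CoreDown ends s A X B Y N) :
    ∀ (ends : E → Sym2 V) (A X B Y : Finset V), RvdBK ends s A X B Y := by
  have hH : ∀ (ends : E → Sym2 V) (P : V → PairType), (∀ v, (P v).IsHarris) → PStmt ends s P := by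
    intro ends P hP
    obtain ⟨h1, h2, h3, h4⟩ := har_props P
    have h := hCD ends (harA P) (harX P) (harB P) (harY P) (harN P) h1 h2 h3 h4
    unfold CoreDown coreCount at h
    unfold PStmt
    rw [show lwt ∘ P = coreW (harA P) (harX P) (harB P) (harY P) (harN P) from
        funext fun v => (coreW_eq_lwt P hP v).symm,
      show rwt ∘ P = coreW (harA P ∪ harB P) ∅ ∅ (harX P ∪ harY P) (harN P) from
        funext fun v => (coreW_right_eq_rwt P hP v).symm]
    exact h
  intro ends A X B Y
  by_cases hAX : Disjoint A X
  · by_cases hBY : Disjoint B Y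
    · have h := pstmt_of_harris s hH ends (instType A X B Y)
      unfold PStmt at h
      unfold RvdBK
      rw [reimerCount_eq_pcount, reimerCount_eq_pcount,
        show lwMark A X B Y = lwt ∘ instType A X B Y from funext (lwMark_eq_lwt hAX hBY),
        show lwMark (A ∪ B) (X ∩ Y) ∅ (X ∪ Y) = rwt ∘ instType A X B Y from
          funext (lwMark_right_eq_rwt hAX hBY)]
      exact h
    · unfold RvdBK
      rw [reimerCount_eq_zero_of_not_disjoint_right ends s A X hBY]
      exact Nat.zero_le _
  · unfold RvdBK
    rw [reimerCount_eq_zero_of_not_disjoint_left ends s hAX B Y]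
    exact Nat.zero_le _

end ReimerVdBK
end Summit.Ventures.PercRepro2
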